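import Summits.ResolutionOfSingularities.ResolutionOfSingularities.Theorems.WeightedInvariantELadderTwoGenSingNonempty
import Summits.ResolutionOfSingularities.ResolutionOfSingularities.Theorems.WeightedInvariantOrbitChartContraction
import Summits.ResolutionOfSingularities.ResolutionOfSingularities.Theorems.WeightedInvariantELadderOneSingOffCentre
import HarnessLib

/-!
# E-ladder rung `e = 2`, step piece (S-b2), READINGS BELOW: orbit-genericity DESCENDS along an induced atlas

[OURS · L1 W4.3 · DOOR `HypersurfaceCentreConstruction` (stmt-ResolutionOfSingularities-19897) · E2 STEP piece (S-b2')
`E2AtlasReadingsCoverBody p` of the registrar's SPEC (Δ6b) rev 5 (`L/res-L1-w43-plan-1/E2Step_split_sketch.lean`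
24a409bbae4c8c6c), ORDER/OFFER (o59-b2); written by res-D-pv-048 (gen 11).  Def-free kernel lemmas; `--supports` the door
item as a helper.  Replaces the role of: nothing printed — OURS bookkeeping of the E-ladder, NOT a statement of the manuscript
[Hironaka2017] or of any manuscript under adjudication; candidates not facts; AI work, weaker than expert review.]

THE DESCENT.  `Stage.IsOrbitGeneric S η` asks, on EVERY unit chart `W a ∋ η`, that the prime `𝔭_a(η)` of `Γ(Y, W a)` be
homogeneous with graded-simple quotient.  On a unit chart through `η = i x` this is EQUIVALENT to
«`𝔭_a(i x)` is homogeneous and `q x` is a CLOSED point of the quotient `V`»: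

* `Stage.isMaximal_primeIdealOf_q_of_gradedSimple` (⇒): `𝔭` homogeneous with degree-`0` units modulo `𝔭` ⇒ `𝔭_{U a}(q x)`
  maximal (the degree-`0` part of `Γ(Y, W a) ⧸ 𝔭` is `Γ(V, U a) ⧸ 𝔭(q x)` by `exists_lift` / `exists_preimage`; the degree-`0`
  component of `s t - 1 ∈ 𝔭` is `s t₀ - 1 ∈ 𝔭`); `Stage.isClosed_singleton_of_isMaximal_primeIdealOf` (Jacobson `V`);
* `Stage.gradedSimple_of_isHomogeneous_of_isClosed` (⇐): res-D-pv-031's `fibreIdeal_le_primeIdealOf_iff` +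
  `isUnit_quotient_mk_of_degreeZero_of_fibreIdeal_le` + res-type-047's `gradedSimple_of_degreeZero_of_units`.

Hence **`Stage.isOrbitGeneric_descent`** (successor stage with an INDUCED atlas: chart map, graded `π♯`, COVER, UNITS;
`q' ≫ ρ = σ_X ≫ q` with `ρ` universally closed): orbit-genericity of `i' x'` implies orbit-genericity of `i (σ_X x')` —
homogeneity pulled back (`isHomogeneous_comap_of_graded`, `IsAffineOpen.comap_primeIdealOf_appLE`), closedness pushed down
(`Scheme.Hom.isClosedMap`).  With `piPlus_mem_singImage_of_not_mem_support` / admissibility (iii-b′) and U6 (res-D-pv-031):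
**`Stage.piPlus_mem_genSing₂_of_mem_genSing₂`** (read points over read points), `Stage.invDim₂_succ` ((I0)₂ of the successor),
and the door's **`LocalEngine.e2AtlasReadingsBelow (p)`** = `E2AtlasReadingsBelowBody p` of SPEC (Δ6b) rev 6, body verbatim.
-/

noncomputable section

set_option linter.dupNamespace false -- mandated namespace of this single-conjunct summit

open CategoryTheory AlgebraicGeometry TopologicalSpace IsLocalRing
open Literature.AlgebraicGeometry.Resolution
open Summit.ResolutionOfSingularities.ResolutionOfSingularities.Theorems

namespace Summit.ResolutionOfSingularities.ResolutionOfSingularities.Theorems.ELadderOne.Stage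

variable {k : Type} [Field k] (S : Stage k)

/-! ## Closed points of the quotient from maximal chart primes -/

/-- In the quotient `V` (locally of finite type over `k`, hence Jacobson) a point of an affine chart whose chart prime is
MAXIMAL is a CLOSED point of `V` (the open immersion `Spec Γ(V, U) ⟶ V` preserves closed points). [folklore] -/
theorem isClosed_singleton_of_isMaximal_primeIdealOf (U : S.V.affineOpens) {v : S.V} (hv : v ∈ (U : S.V.Opens))
    (h : (U.2.primeIdealOf ⟨v, hv⟩).asIdeal.IsMaximal) : IsClosed ({v} : Set S.V) := by
  haveI : JacobsonSpace S.V := LocallyOfFiniteType.jacobsonSpace S.g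
  have h1 : U.2.primeIdealOf ⟨v, hv⟩ ∈ closedPoints (Spec Γ(S.V, U)) :=
    (PrimeSpectrum.isClosed_singleton_iff_isMaximal _).mpr h
  rw [← U.2.fromSpec.isOpenEmbedding.preimage_closedPoints] at h1
  have h2 : U.2.fromSpec (U.2.primeIdealOf ⟨v, hv⟩) ∈ closedPoints S.V := h1
  rw [IsAffineOpen.fromSpec_primeIdealOf] at h2
  exact h2

/-! ## Orbit-generic at a unit chart ⇒ the quotient point is closed -/

/-- **Graded-simple in degree `0` ⇒ the quotient point is closed (maximality).**  On a chart `W a ∋ i x`: if the prime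
`𝔭 = 𝔭_a(i x)` is homogeneous and every degree-`0` section off `𝔭` is a unit modulo `𝔭`, then the prime `𝔭_{U a}(q x)` of
the quotient chart is MAXIMAL: for `c ∉ 𝔭(q x)` lift `c` to a degree-`0` section `s ∉ 𝔭` (`exists_lift`), invert it modulo
`𝔭`, take the degree-`0` component `t₀` of the inverse (`𝔭` is homogeneous) and descend `t₀` to `c'` (`exists_preimage`):
`c c' - 1 ∈ 𝔭(q x)`. [folklore] -/
theorem isMaximal_primeIdealOf_q_of_gradedSimple (a : S.atlas.ι) {x : S.X}
    (hx : S.i.base x ∈ (S.atlas.W a : S.Y.Opens))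
    (hhom : letI := S.atlas.gradedRing a
      (((S.atlas.W a).2.primeIdealOf ⟨S.i.base x, hx⟩).asIdeal).IsHomogeneous (S.atlas.piece a))
    (h0 : ∀ s : Γ(S.Y, S.atlas.W a), s ∈ S.atlas.piece a 0 →
      s ∉ ((S.atlas.W a).2.primeIdealOf ⟨S.i.base x, hx⟩).asIdeal →
      IsUnit (Ideal.Quotient.mk ((S.atlas.W a).2.primeIdealOf ⟨S.i.base x, hx⟩).asIdeal s)) :
    ((S.atlas.U a).2.primeIdealOf ⟨S.q.base x, S.base_mem_U a hx⟩).asIdeal.IsMaximal := by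
  classical
  letI := S.atlas.gradedRing a
  set P := ((S.atlas.W a).2.primeIdealOf ⟨S.i.base x, hx⟩).asIdeal with hP
  set 𝔪 := ((S.atlas.U a).2.primeIdealOf ⟨S.q.base x, S.base_mem_U a hx⟩).asIdeal with h𝔪
  have hx' : x ∈ S.i ⁻¹ᵁ (S.atlas.W a : S.Y.Opens) := hx
  set 𝔭X := ((S.isAffineOpen_preimage_W a).primeIdealOf ⟨x, hx'⟩).asIdeal with h𝔭X
  set φi := (S.i.app (S.atlas.W a)).hom with hφi
  set φq := (S.q.appLE (S.atlas.U a) (S.i ⁻¹ᵁ (S.atlas.W a : S.Y.Opens)) (S.atlas.preimage_eq a).le).hom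
    with hφq
  -- the two contractions of the prime of `x` on `X ∩ W a`
  have key1 : 𝔭X.comap φi = P := S.comap_primeIdealOf_preimage_W a hx
  have key2 : 𝔭X.comap φq = 𝔪 :=
    congrArg PrimeSpectrum.asIdeal (IsAffineOpen.comap_primeIdealOf_appLE (f := S.q) (x := x)
      (S.atlas.U a : S.V.Opens) (S.atlas.U a).2 (S.i ⁻¹ᵁ (S.atlas.W a : S.Y.Opens))
      (S.isAffineOpen_preimage_W a) (S.atlas.preimage_eq a).le hx')
  haveI h𝔪p : 𝔪.IsPrime := ((S.atlas.U a).2.primeIdealOf ⟨S.q.base x, S.base_mem_U a hx⟩).2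
  rw [Ideal.isMaximal_iff]
  refine ⟨fun h1 => h𝔪p.ne_top ((Ideal.eq_top_iff_one _).mpr h1), fun J c hJ hc𝔪 hcJ => ?_⟩
  -- lift `c` to a degree-`0` section `s ∉ P`
  obtain ⟨s, hs0, hs⟩ := S.atlas.exists_lift a c
  have hsc : φq c = φi s := hs
  have hsP : s ∉ P := by
    intro h
    apply hc𝔪
    rw [← key2, Ideal.mem_comap, hsc]
    rw [← key1, Ideal.mem_comap] at h
    exact h
  -- invert `s` modulo `P`, degree-`0` component of the inverse
  obtain ⟨u, hu⟩ := h0 s hs0 hsP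
  obtain ⟨t, ht⟩ := Ideal.Quotient.mk_surjective (↑u⁻¹ : Γ(S.Y, S.atlas.W a) ⧸ P)
  have hst : s * t - 1 ∈ P := by
    rw [← Ideal.Quotient.eq, map_mul, map_one, ht, ← hu, Units.mul_inv]
  set t₀ : Γ(S.Y, S.atlas.W a) := (DirectSum.decompose (S.atlas.piece a) t 0 : Γ(S.Y, S.atlas.W a)) with ht₀
  have ht₀0 : t₀ ∈ S.atlas.piece a 0 := SetLike.coe_mem _
  have hst₀ : s * t₀ - 1 ∈ P := by
    have h := hhom 0 hst
    have hdec : (DirectSum.decompose (S.atlas.piece a) (s * t - 1) 0 : Γ(S.Y, S.atlas.W a)) = s * t₀ - 1 := by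
      rw [DirectSum.decompose_sub, DirectSum.sub_apply, AddSubgroupClass.coe_sub,
        DirectSum.coe_decompose_mul_of_left_mem_zero (S.atlas.piece a) hs0,
        DirectSum.decompose_of_mem_same (S.atlas.piece a) (SetLike.GradedOne.one_mem (A := S.atlas.piece a))]
    rw [hdec] at h
    exact h
  -- descend `t₀` to the quotient chart
  obtain ⟨c', hc'⟩ := S.atlas.exists_preimage a t₀ ht₀0
  have hsc' : φq c' = φi t₀ := hc'
  have hcc' : c * c' - 1 ∈ 𝔪 := by
    rw [← key2, Ideal.mem_comap, map_sub, map_mul, map_one, hsc, hsc', ← map_one φi, ← map_mul, ← map_sub,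
      ← Ideal.mem_comap, key1]
    exact hst₀
  have h1 : (1 : Γ(S.V, S.atlas.U a)) = c * c' - (c * c' - 1) := by ring
  rw [h1]
  exact J.sub_mem (J.mul_mem_right _ hcJ) (hJ hcc')

/-- **Orbit-generic at a unit chart ⇒ the quotient point is CLOSED in `V`.** [folklore] -/
theorem isClosed_singleton_q_of_gradedSimple (a : S.atlas.ι) {x : S.X}
    (hx : S.i.base x ∈ (S.atlas.W a : S.Y.Opens))
    (hhom : letI := S.atlas.gradedRing a
      (((S.atlas.W a).2.primeIdealOf ⟨S.i.base x, hx⟩).asIdeal).IsHomogeneous (S.atlas.piece a))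
    (h0 : ∀ s : Γ(S.Y, S.atlas.W a), s ∈ S.atlas.piece a 0 →
      s ∉ ((S.atlas.W a).2.primeIdealOf ⟨S.i.base x, hx⟩).asIdeal →
      IsUnit (Ideal.Quotient.mk ((S.atlas.W a).2.primeIdealOf ⟨S.i.base x, hx⟩).asIdeal s)) :
    IsClosed ({S.q.base x} : Set S.V) :=
  S.isClosed_singleton_of_isMaximal_primeIdealOf (S.atlas.U a) (S.base_mem_U a hx)
    (S.isMaximal_primeIdealOf_q_of_gradedSimple a hx hhom h0)

/-- **An orbit-generic point `i x` lies over a CLOSED point `q x` of the quotient** (read on any unit chart through it).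
[folklore] -/
theorem isClosed_singleton_q_of_isOrbitGeneric {x : S.X} (hog : S.IsOrbitGeneric (S.i.base x)) :
    IsClosed ({S.q.base x} : Set S.V) := by
  obtain ⟨a, hxa, ha⟩ := S.exists_isUnitChart x
  obtain ⟨hhom, hgs⟩ := hog a ha hxa
  exact S.isClosed_singleton_q_of_gradedSimple a hxa hhom (fun s hs0 hsP => hgs 0 s hs0 hsP)

/-! ## Homogeneous prime over a closed quotient point ⇒ orbit-generic at the chart -/

/-- **On a unit chart, a homogeneous chart prime over a CLOSED quotient point has graded-simple quotient**
(res-D-pv-031's fibre-ideal lemmas and res-type-047's criterion). [folklore] -/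
theorem gradedSimple_of_isHomogeneous_of_isClosed {a : S.atlas.ι} (ha : S.IsUnitChart a) {x : S.X}
    (hx : S.i.base x ∈ (S.atlas.W a : S.Y.Opens))
    (hcl : IsClosed ({S.q.base x} : Set S.V)) :
    letI := S.atlas.gradedRing a
    ∀ (d : Fin S.j → ℤ) (y : Γ(S.Y, S.atlas.W a)), y ∈ S.atlas.piece a d →
      y ∉ ((S.atlas.W a).2.primeIdealOf ⟨S.i.base x, hx⟩).asIdeal →
        IsUnit (Ideal.Quotient.mk ((S.atlas.W a).2.primeIdealOf ⟨S.i.base x, hx⟩).asIdeal y) := by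
  letI := S.atlas.gradedRing a
  have hv := S.base_mem_U a hx
  haveI : (((S.atlas.W a).2.primeIdealOf ⟨S.i.base x, hx⟩).asIdeal).IsPrime :=
    ((S.atlas.W a).2.primeIdealOf ⟨S.i.base x, hx⟩).2
  have hJP := (S.fibreIdeal_le_primeIdealOf_iff a hv hcl hx).mpr rfl
  have h0 : ∀ ⦃s : Γ(S.Y, S.atlas.W a)⦄, s ∈ S.atlas.piece a 0 →
      s ∉ ((S.atlas.W a).2.primeIdealOf ⟨S.i.base x, hx⟩).asIdeal →
      IsUnit (Ideal.Quotient.mk ((S.atlas.W a).2.primeIdealOf ⟨S.i.base x, hx⟩).asIdeal s) :=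
    fun s hs0 hsP => S.isUnit_quotient_mk_of_degreeZero_of_fibreIdeal_le a hv hcl hJP hs0 hsP
  have hgs := gradedSimple_of_degreeZero_of_units (S.atlas.piece a) h0
    (Nat.pos_iff_ne_zero.mp S.atlas.exponent_pos)
    (fun χ => S.exists_isUnit_quotient_of_isUnitChart ha hx ⟨x, rfl⟩ χ)
  exact fun d y hy hyP => hgs d hy hyP

/-! ## The descent of orbit-genericity along an induced atlas -/

/-- **DESCENT OF ORBIT-GENERICITY.**  Let `S'` be a stage over `S`: `π : Y' ⟶ Y`, `σ_X : X' ⟶ X` with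
`σ_X ≫ i = i' ≫ π`, and `ρ : V' ⟶ V` universally closed with `q' ≫ ρ = σ_X ≫ q`; suppose the atlas of `S'` is INDUCED from
the atlas of `S`: a chart map `oc` with `W' a' ≤ π⁻¹ W (oc a')`, `π♯ : Γ(Y, W (oc a')) → Γ(Y', W' a')` graded along an
injective degree map `g`, COVER (over every old chart through `π (i' x')` there is a successor chart through `i' x'`) and
UNITS (a unit chart below gives a unit chart above).  If `i' x'` is orbit-generic for `S'`, then `i (σ_X x')` is orbit-generic
for `S`: on a unit chart `W a ∋ i (σ_X x')` pick `a'` over `a` through `i' x'` (a unit chart); the prime of `i (σ_X x')` is the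
contraction of the (homogeneous) prime of `i' x'` along the graded `π♯`, hence homogeneous; `q' x'` is a closed point of
`V'`, so `q (σ_X x') = ρ (q' x')` is a closed point of `V`, and a homogeneous chart prime over a closed quotient point has
graded-simple quotient. [folklore] -/
theorem isOrbitGeneric_descent (S' : Stage k) (π : S'.Y ⟶ S.Y) (σX : S'.X ⟶ S.X)
    (hσX : σX ≫ S.i = S'.i ≫ π) (ρ : S'.V ⟶ S.V) [UniversallyClosed ρ] (hρq : S'.q ≫ ρ = σX ≫ S.q)
    (oc : S'.atlas.ι → S.atlas.ι)
    (hle : ∀ a', (S'.atlas.W a' : S'.Y.Opens) ≤ π ⁻¹ᵁ (S.atlas.W (oc a') : S.Y.Opens))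
    (g : (Fin S.j → ℤ) → (Fin S'.j → ℤ)) (hg : Function.Injective g)
    (hgr : ∀ (a' : S'.atlas.ι) (χ : Fin S.j → ℤ) (s : Γ(S.Y, S.atlas.W (oc a'))), s ∈ S.atlas.piece (oc a') χ →
      π.appLE (S.atlas.W (oc a')) (S'.atlas.W a') (hle a') s ∈ S'.atlas.piece a' (g χ))
    (hcov : ∀ (x' : S'.X) (a : S.atlas.ι), π.base (S'.i.base x') ∈ (S.atlas.W a : S.Y.Opens) →
      ∃ a', oc a' = a ∧ S'.i.base x' ∈ (S'.atlas.W a' : S'.Y.Opens))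
    (hunit : ∀ a', S.IsUnitChart (oc a') → S'.IsUnitChart a')
    {x' : S'.X} (hog : S'.IsOrbitGeneric (S'.i.base x')) :
    S.IsOrbitGeneric (S.i.base (σX.base x')) := by
  classical
  have hy : π.base (S'.i.base x') = S.i.base (σX.base x') := by
    rw [← Scheme.Hom.comp_apply, ← hσX, Scheme.Hom.comp_apply]
  have hq : S.q.base (σX.base x') = ρ.base (S'.q.base x') := by
    rw [← Scheme.Hom.comp_apply, ← hρq, Scheme.Hom.comp_apply]
  intro a ha hya
  -- a successor unit chart over `a` through `i' x'`
  have hya' : π.base (S'.i.base x') ∈ (S.atlas.W a : S.Y.Opens) := by rw [hy]; exact hya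
  obtain ⟨a', hoc, hxa'⟩ := hcov x' a hya'
  subst hoc
  have ha' : S'.IsUnitChart a' := hunit a' ha
  obtain ⟨hhom', hgs'⟩ := hog a' ha' hxa'
  letI := S.atlas.gradedRing (oc a')
  letI := S'.atlas.gradedRing a'
  -- (1) homogeneity: the prime below is the contraction of the prime above along the graded `π♯`
  have hcomap := IsAffineOpen.comap_primeIdealOf_appLE (f := π) (x := S'.i.base x')
    (S.atlas.W (oc a') : S.Y.Opens) (S.atlas.W (oc a')).2 (S'.atlas.W a' : S'.Y.Opens) (S'.atlas.W a').2 (hle a') hxa'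
  have hpt : (⟨π.base (S'.i.base x'), hle a' hxa'⟩ : (S.atlas.W (oc a') : S.Y.Opens)) =
      ⟨S.i.base (σX.base x'), hya⟩ := Subtype.ext hy
  rw [hpt] at hcomap
  have hP := congrArg PrimeSpectrum.asIdeal hcomap
  have hhom : (((S.atlas.W (oc a')).2.primeIdealOf ⟨S.i.base (σX.base x'), hya⟩).asIdeal).IsHomogeneous
      (S.atlas.piece (oc a')) := by
    rw [← hP]
    exact isHomogeneous_comap_of_graded (S.atlas.piece (oc a')) (S'.atlas.piece a') _ g hg (hgr a') hhom'
  -- (2) the quotient point is closed: closed above, pushed down along the universally closed `ρ`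
  have hcl' : IsClosed ({S'.q.base x'} : Set S'.V) :=
    S'.isClosed_singleton_q_of_gradedSimple a' hxa' hhom' (fun s hs0 hsP => hgs' 0 s hs0 hsP)
  have hcl : IsClosed ({S.q.base (σX.base x')} : Set S.V) := by
    rw [hq, ← Set.image_singleton]
    exact ρ.isClosedMap _ hcl'
  -- (3) homogeneous prime over a closed quotient point on a unit chart: graded-simple
  exact ⟨hhom, S.gradedSimple_of_isHomogeneous_of_isClosed ha hya hcl⟩

/-! ## The successor stage over the cobordant blow-up: (I0)₂ and read points over read points -/

/-- **(I0)₂ OF THE SUCCESSOR**: `dim X' = dim X + 1 = (j + 1) + 2` for the strict transform over the cobordant blow-up of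
a regular weighted centre whose support misses the generic point of `X` (`topologicalKrullDim_strictTransformPlus`); the
presentation `(V', ρ, q', 𝒜')` is arbitrary. [folklore] -/
theorem invDim₂_succ (hInv : S.InvDim₂) (R : ReesAlgebraData S.Y) (hc : R.IsRegularWeightedCentre)
    (hξ : S.i (genericPoint S.X) ∉ R.support) (R' : ReesFiltration S.Y) (hR' : R'.ideal = R.piece)
    [Smooth (R'.πPlus ≫ S.f)] [IsSeparated (R'.πPlus ≫ S.f)] [QuasiCompact (R'.πPlus ≫ S.f)]
    [IsIntegral (R'.strictTransformPlus S.i.ker).subscheme]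
    (hlp' : IsLocallyPrincipal (R'.strictTransformPlus S.i.ker).subschemeι.ker)
    (V' : Scheme.{0}) (ρ : V' ⟶ S.V) [IsIntegral V'] [IsProper ρ]
    (q' : (R'.strictTransformPlus S.i.ker).subscheme ⟶ V')
    (hq' : q' ≫ ρ ≫ S.g = (R'.strictTransformPlus S.i.ker).subschemeι ≫ R'.πPlus ≫ S.f)
    (𝒜' : GradedAtlas (S.j + 1) (R'.πPlus ≫ S.f) (R'.strictTransformPlus S.i.ker).subschemeι q') :
    Stage.InvDim₂ (⟨R'.plus, R'.πPlus ≫ S.f, (R'.strictTransformPlus S.i.ker).subscheme,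
        (R'.strictTransformPlus S.i.ker).subschemeι, hlp', V', q', ρ ≫ S.g, hq', S.j + 1, 𝒜'⟩ : Stage k) := by
  change topologicalKrullDim ↥(R'.strictTransformPlus S.i.ker).subscheme = ((S.j + 1 + 2 : ℕ) : WithBot ℕ∞)
  rw [StrictTransformDimension.topologicalKrullDim_strictTransformPlus S.f S.i R hc hξ R' hR', hInv]
  norm_cast

/-- **READ POINTS OF THE SUCCESSOR LIE OVER READ POINTS** (the «below» conjunct of `E2AtlasReadingsCoverBody`): for a
non-regular (I0)₂ stage `S`, an ADMISSIBLE centre `R`, its Rees filtration `R'` and a successor presentation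
`(V', ρ, q', 𝒜')` over `R'.plus` with the lift `σ_X` (`σ_X ≫ i = i' ≫ σ₊`, `q' ≫ ρ = σ_X ≫ q`) whose atlas is induced
along `σ₊` (chart map, `hle`, graded `σ₊♯`, COVER, UNITS at exponent `𝒜'.exponent`), every point of `genSing₂` of the
successor stage maps under `σ₊` into `genSing₂ S`: into `singImage` (over the support by admissibility (iii-b′), off it by
`piPlus_mem_singImage_of_not_mem_support`), orbit-generic by `isOrbitGeneric_descent`, and with ambient stalk of dimension
`≤ 3` by U6 (`ringKrullDim_stalk_le_three_of_isOrbitGeneric`). [folklore] -/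
theorem piPlus_mem_genSing₂_of_mem_genSing₂ (hInv : S.InvDim₂) (R : ReesAlgebraData S.Y)
    (hadm : IsAdmissibleCentre S.f S.i.ker R) (R' : ReesFiltration S.Y) (hR' : R'.ideal = R.piece)
    [Smooth (R'.πPlus ≫ S.f)] [IsSeparated (R'.πPlus ≫ S.f)] [QuasiCompact (R'.πPlus ≫ S.f)]
    [IsIntegral (R'.strictTransformPlus S.i.ker).subscheme]
    (hlp' : IsLocallyPrincipal (R'.strictTransformPlus S.i.ker).subschemeι.ker)
    (V' : Scheme.{0}) (ρ : V' ⟶ S.V) [IsIntegral V'] [IsProper ρ]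
    (q' : (R'.strictTransformPlus S.i.ker).subscheme ⟶ V')
    (hq' : q' ≫ ρ ≫ S.g = (R'.strictTransformPlus S.i.ker).subschemeι ≫ R'.πPlus ≫ S.f)
    (σX : (R'.strictTransformPlus S.i.ker).subscheme ⟶ S.X)
    (hσX : σX ≫ S.i = (R'.strictTransformPlus S.i.ker).subschemeι ≫ R'.πPlus) (hρq : q' ≫ ρ = σX ≫ S.q)
    (𝒜' : GradedAtlas (S.j + 1) (R'.πPlus ≫ S.f) (R'.strictTransformPlus S.i.ker).subschemeι q')
    (oc : 𝒜'.ι → S.atlas.ι)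
    (hle : ∀ a' : 𝒜'.ι, (𝒜'.W a' : (R'.plus : Scheme.{0}).Opens) ≤ R'.πPlus ⁻¹ᵁ (S.atlas.W (oc a') : S.Y.Opens))
    (hgr : ∀ (a' : 𝒜'.ι) (χ : Fin S.j → ℤ) (s : Γ(S.Y, S.atlas.W (oc a'))), s ∈ S.atlas.piece (oc a') χ →
      R'.πPlus.appLE (S.atlas.W (oc a')) (𝒜'.W a') (hle a') s ∈ 𝒜'.piece a' (Fin.snoc (α := fun _ => ℤ) χ 0))
    (hcov : ∀ (x' : ↥(R'.strictTransformPlus S.i.ker).subscheme) (a : S.atlas.ι),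
      R'.πPlus.base ((R'.strictTransformPlus S.i.ker).subschemeι.base x') ∈ (S.atlas.W a : S.Y.Opens) →
      ∃ a' : 𝒜'.ι, oc a' = a ∧
        (R'.strictTransformPlus S.i.ker).subschemeι.base x' ∈ (𝒜'.W a' : (R'.plus : Scheme.{0}).Opens))
    (hunit : ∀ a' : 𝒜'.ι,
      (∀ χ : Fin S.j → ℤ, ∃ s ∈ S.atlas.piece (oc a') (S.atlas.exponent • χ), IsUnit (S.i.app (S.atlas.W (oc a')) s)) →
      ∀ χ' : Fin (S.j + 1) → ℤ, ∃ s' ∈ 𝒜'.piece a' (𝒜'.exponent • χ'),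
        IsUnit ((R'.strictTransformPlus S.i.ker).subschemeι.app (𝒜'.W a') s')) :
    ∀ η' ∈ Stage.genSing₂ (⟨R'.plus, R'.πPlus ≫ S.f, (R'.strictTransformPlus S.i.ker).subscheme,
        (R'.strictTransformPlus S.i.ker).subschemeι, hlp', V', q', ρ ≫ S.g, hq', S.j + 1, 𝒜'⟩ : Stage k),
      R'.πPlus.base η' ∈ S.genSing₂ := by
  set S' : Stage k := ⟨R'.plus, R'.πPlus ≫ S.f, (R'.strictTransformPlus S.i.ker).subscheme,
    (R'.strictTransformPlus S.i.ker).subschemeι, hlp', V', q', ρ ≫ S.g, hq', S.j + 1, 𝒜'⟩ with hS'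
  intro η' hη'
  obtain ⟨hsing', hog', -⟩ := hη'
  -- `η' = i' x'`
  obtain ⟨x', hx'⟩ := S'.mem_range_of_mem_singImage hsing'
  subst hx'
  -- orbit-genericity descends
  have hg : Function.Injective (fun χ : Fin S.j → ℤ => (Fin.snoc (α := fun _ => ℤ) χ 0 : Fin (S.j + 1) → ℤ)) := by
    intro χ₁ χ₂ h
    have h' := congrArg Fin.init h
    simpa only [Fin.init_snoc] using h'
  have hog : S.IsOrbitGeneric (S.i.base (σX.base x')) :=
    S.isOrbitGeneric_descent S' R'.πPlus σX hσX ρ hρq oc hle _ hg hgr hcov hunit hog'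
  have hy : R'.πPlus.base (S'.i.base x') = S.i.base (σX.base x') := by
    rw [← Scheme.Hom.comp_apply, ← hσX, Scheme.Hom.comp_apply]
  rw [hy]
  -- the non-regular image below
  have hsing : S.i.base (σX.base x') ∈ singImage S.i.ker := by
    by_cases hsupp : S.i.base (σX.base x') ∈ R.support
    · exact hadm.2.1 hsupp
    · have hsing'' : S'.i.base x' ∈ singImage (R'.strictTransformPlus S.i.ker) := by
        have h := hsing'
        rw [show S'.i.ker = R'.strictTransformPlus S.i.ker from Scheme.IdealSheafData.ker_subschemeι _] at h
        exact h
      rw [← hy] at hsupp ⊢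
      exact ELadderOne.piPlus_mem_singImage_of_not_mem_support S.f S.i R hadm.1 R' hR' _ hsing'' hsupp
  exact ⟨hsing, hog, S.ringKrullDim_stalk_le_three_of_isOrbitGeneric hInv hsing hog⟩

end Summit.ResolutionOfSingularities.ResolutionOfSingularities.Theorems.ELadderOne.Stage

/-! ## (S-b2-below') for the door: `E2AtlasReadingsBelowBody`, body verbatim -/

namespace Summit.ResolutionOfSingularities.ResolutionOfSingularities.Cruxes.HypersurfaceCentreConstruction.LocalEngine

open Summit.ResolutionOfSingularities.ResolutionOfSingularities.Theorems.ELadderOne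

/-- **(S-b2-below') `E2AtlasReadingsBelowBody p` — THE BODY VERBATIM** (registrar's SPEC (Δ6b) rev 6
`L/res-L1-w43-plan-1/E2Step_split_sketch.lean` 6d21cd592fd98c12 l.340, with `InducedAlongCover S R R' Dg ρ 𝒜'` (l.236) spelled
out as the hypothesis): for a non-regular (I0)₂ stage over a perfect field of characteristic `p`, an admissible centre `R` with the
generic point of `X` off its support, its Rees filtration `R'`, ANY Veronese degree `Dg > 0` and ANY successor presentation
`(V', ρ, q', σ_X, 𝒜')` (`ρ` the blow-up of `K_{Dg}`, `q' ≫ ρ = σ_X ≫ q`) whose atlas is `InducedAlongCover`: (I0)₂ of the successor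
and every successor read point lies over a read point of `S` (`Stage.invDim₂_succ` + `Stage.piPlus_mem_genSing₂_of_mem_genSing₂`; the
hypotheses `¬ IsRegular`, `CharP`, `PerfectField`, `0 < Dg`, `IsBlowup` and most of the dictionary are idle). [folklore] -/
theorem e2AtlasReadingsBelow (p : ℕ) :
  ∀ ⦃k : Type⦄ [Field k] [CharP k p] [PerfectField k] (S : Stage k), S.InvDim₂ → ¬ Scheme.IsRegular S.X →
    ∀ (R : ReesAlgebraData S.Y), IsAdmissibleCentre S.f S.i.ker R → S.i (genericPoint S.X) ∉ R.support →
      ∀ (R' : ReesFiltration S.Y), R'.ideal = R.piece →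
    ∀ [Smooth (R'.πPlus ≫ S.f)] [IsSeparated (R'.πPlus ≫ S.f)] [QuasiCompact (R'.πPlus ≫ S.f)]
      [IsIntegral (R'.strictTransformPlus S.i.ker).subscheme]
      (hlp' : IsLocallyPrincipal (R'.strictTransformPlus S.i.ker).subschemeι.ker)
      (Dg : ℕ) (_ : 0 < Dg)
      (V' : Scheme.{0}) (ρ : V' ⟶ S.V) [IsIntegral V'] [IsProper ρ]
      (_ : IsBlowup ρ ((((R.piece Dg).comap S.i).subschemeι ≫ S.q).ker))
      (q' : (R'.strictTransformPlus S.i.ker).subscheme ⟶ V')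
      (hq' : q' ≫ ρ ≫ S.g = (R'.strictTransformPlus S.i.ker).subschemeι ≫ R'.πPlus ≫ S.f)
      (σX : (R'.strictTransformPlus S.i.ker).subscheme ⟶ S.X)
      (_ : σX ≫ S.i = (R'.strictTransformPlus S.i.ker).subschemeι ≫ R'.πPlus) (_ : q' ≫ ρ = σX ≫ S.q)
      (𝒜' : GradedAtlas (S.j + 1) (R'.πPlus ≫ S.f) (R'.strictTransformPlus S.i.ker).subschemeι q'),
    (∃ (oc : 𝒜'.ι → S.atlas.ι)
        (hle : ∀ a' : 𝒜'.ι,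
          (𝒜'.W a' : (R'.plus : Scheme.{0}).Opens) ≤ R'.πPlus ⁻¹ᵁ (S.atlas.W (oc a') : S.Y.Opens)),
        𝒜'.exponent = S.atlas.exponent * Dg ∧
        (∀ (x' : ↥(R'.strictTransformPlus S.i.ker).subscheme) (a : S.atlas.ι),
          R'.πPlus.base ((R'.strictTransformPlus S.i.ker).subschemeι.base x') ∈ (S.atlas.W a : S.Y.Opens) →
          ∃ a' : 𝒜'.ι, oc a' = a ∧
            (R'.strictTransformPlus S.i.ker).subschemeι.base x' ∈ (𝒜'.W a' : (R'.plus : Scheme.{0}).Opens)) ∧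
        (∀ (a' : 𝒜'.ι) (e : ℕ),
          (∀ χ : Fin S.j → ℤ, ∃ s ∈ S.atlas.piece (oc a') (e • χ), IsUnit (S.i.app (S.atlas.W (oc a')) s)) →
          ∀ χ' : Fin (S.j + 1) → ℤ, ∃ s' ∈ 𝒜'.piece a' ((e * Dg) • χ'),
            IsUnit ((R'.strictTransformPlus S.i.ker).subschemeι.app (𝒜'.W a') s')) ∧
        ∀ a' : 𝒜'.ι,
          (∀ (χ : Fin S.j → ℤ) (s : Γ(S.Y, S.atlas.W (oc a'))), s ∈ S.atlas.piece (oc a') χ →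
            R'.πPlus.appLE (S.atlas.W (oc a')) (𝒜'.W a') (hle a') s ∈
              𝒜'.piece a' (Fin.snoc (α := fun _ => ℤ) χ 0)) ∧
          tInvOn R' (𝒜'.W a') ∈ 𝒜'.piece a' (Fin.snoc (α := fun _ => ℤ) 0 (-1)) ∧
          ∃ (β : Γ(S.Y, S.atlas.W (oc a'))) (η : Γ((R'.plus : Scheme.{0}), 𝒜'.W a')),
            β ∈ (R.piece Dg).ideal (S.atlas.W (oc a')) ∧ β ∈ S.atlas.piece (oc a') 0 ∧ IsUnit η ∧
            η ∈ 𝒜'.piece a' (Fin.snoc (α := fun _ => ℤ) 0 (Dg : ℤ)) ∧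
            η * tInvOn R' (𝒜'.W a') ^ Dg = R'.πPlus.appLE (S.atlas.W (oc a')) (𝒜'.W a') (hle a') β ∧
            (∀ y' : (R'.plus : Scheme.{0}), y' ∈ (𝒜'.W a' : (R'.plus : Scheme.{0}).Opens) ↔
              ∃ (O : (R'.plus : Scheme.{0}).affineOpens)
                (hO : (O : (R'.plus : Scheme.{0}).Opens) ≤ R'.πPlus ⁻¹ᵁ (S.atlas.W (oc a') : S.Y.Opens)),
                y' ∈ (O : (R'.plus : Scheme.{0}).Opens) ∧ ∃ η₀ : Γ((R'.plus : Scheme.{0}), O),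
                  IsUnit η₀ ∧ η₀ * tInvOn R' O ^ Dg = R'.πPlus.appLE (S.atlas.W (oc a')) O hO β) ∧
            (∀ s ∈ 𝒜'.piece a' 0, ∃ (l : ℕ) (x : Γ(S.Y, S.atlas.W (oc a'))),
              x ∈ (R.piece (Dg * l)).ideal (S.atlas.W (oc a')) ∧ x ∈ S.atlas.piece (oc a') 0 ∧
                s * η ^ l * tInvOn R' (𝒜'.W a') ^ (Dg * l) =
                  R'.πPlus.appLE (S.atlas.W (oc a')) (𝒜'.W a') (hle a') x) ∧
            (∀ (l : ℕ) (x : Γ(S.Y, S.atlas.W (oc a'))), x ∈ (R.piece (Dg * l)).ideal (S.atlas.W (oc a')) →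
              x ∈ S.atlas.piece (oc a') 0 → ∃ s ∈ 𝒜'.piece a' 0,
                s * η ^ l * tInvOn R' (𝒜'.W a') ^ (Dg * l) =
                  R'.πPlus.appLE (S.atlas.W (oc a')) (𝒜'.W a') (hle a') x) ∧
            (∀ x : Γ(S.Y, S.atlas.W (oc a')), R'.πPlus.appLE (S.atlas.W (oc a')) (𝒜'.W a') (hle a') x ∈
              (R'.strictTransformPlus S.i.ker).ideal (𝒜'.W a') → x * β ∈ S.i.ker.ideal (S.atlas.W (oc a'))) ∧
            ∃ b : Γ(S.V, S.atlas.U (oc a')),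
              b ∈ ((((R.piece Dg).comap S.i).subschemeι ≫ S.q).ker).ideal (S.atlas.U (oc a')) ∧
              S.i.app (S.atlas.W (oc a')) β =
                S.q.appLE (S.atlas.U (oc a')) (S.i ⁻¹ᵁ (S.atlas.W (oc a'))) (S.atlas.preimage_eq (oc a')).le b ∧
              (𝒜'.U a' : V'.Opens) =
                blowupChart ρ ((((R.piece Dg).comap S.i).subschemeι ≫ S.q).ker) (S.atlas.U (oc a')) b) →
      Stage.InvDim₂ (⟨R'.plus, R'.πPlus ≫ S.f, (R'.strictTransformPlus S.i.ker).subscheme,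
          (R'.strictTransformPlus S.i.ker).subschemeι, hlp', V', q', ρ ≫ S.g, hq', S.j + 1, 𝒜'⟩ : Stage k) ∧
      ∀ η' ∈ Stage.genSing₂ (⟨R'.plus, R'.πPlus ≫ S.f, (R'.strictTransformPlus S.i.ker).subscheme,
          (R'.strictTransformPlus S.i.ker).subschemeι, hlp', V', q', ρ ≫ S.g, hq', S.j + 1, 𝒜'⟩ : Stage k),
        R'.πPlus.base η' ∈ S.genSing₂ := by
  intro k _ _ _ S hInv _ R hadm hξ R' hR' _ _ _ _ hlp' Dg _ V' ρ _ _ _ q' hq' σX hσX hρq 𝒜' hcover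
  obtain ⟨oc, hle, hexp, hcov, hunit, hdict⟩ := hcover
  refine ⟨Stage.invDim₂_succ S hInv R hadm.1 hξ R' hR' hlp' V' ρ q' hq' 𝒜', ?_⟩
  exact Stage.piPlus_mem_genSing₂_of_mem_genSing₂ S hInv R hadm R' hR' hlp' V' ρ q' hq' σX hσX hρq 𝒜' oc hle
    (fun a' χ s hs => (hdict a').1 χ s hs) hcov
    (fun a' ha χ' => by
      obtain ⟨s', hs', hu⟩ := hunit a' S.atlas.exponent ha χ'
      exact ⟨s', hexp ▸ hs', hu⟩)

end Summit.ResolutionOfSingularities.ResolutionOfSingularities.Cruxes.HypersurfaceCentreConstruction.LocalEngine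

end
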